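import Literature.MathematicalPhysics.QuantumFieldTheory.Balaban1983to89.B9C2LettersTorusY
import Literature.MathematicalPhysics.QuantumFieldTheory.Balaban1983to89.B9C2LettersRealSymm
import Literature.MathematicalPhysics.QuantumFieldTheory.Balaban1983to89.B9C2LettersTorusYCov
import Literature.MathematicalPhysics.QuantumFieldTheory.Balaban1983to89.Node00.OpsYD2JForm
import Literature.MathematicalPhysics.QuantumFieldTheory.Balaban1983to89.Node00.OpsYDelta2FormP

/-!
# `Balaban1983to89.Node00.OpsYC2OfRecord` — T. Bałaban, *Propagators for lattice gauge theories in a background field*, Commun. Math. Phys. **99**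
# (1985) 389–434 [Balaban1985BackgroundPropagators], p. 421 (the two sentences after (3.127)) with (3.134)∕(3.136) p. 422, and *Averaging operations
# for lattice gauge theories*, Commun. Math. Phys. **98** (1985) 17–51 [Balaban1985Averaging], (136) p. 39: ★★★ THE FORM LETTER `C⁽²⁾` OF RECORD —
# THE DERIVED SCALE WEIGHT `w(c) = iη ∕ (2L^{j(c)})`, the letter `c2YOfRecord`, the certificate's `h𝔠real` ∕ `hΔ2` WITH NOTHING DISPLAYED, and the
# v9 instance `opsYOfRecordV9E` (the parameter `𝔠` REMOVED from the record); EDITION 2: the covariance law the letter DOES satisfy — corner-keyed,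
# unitary gauge functions (`C2LettersY.IsCovUC`, `c2YOfRecord_isCovUC`) — and the erratum on the displayed `IsCov`

statement-level skeleton of published theorems with citation tags; proofs where landed; nothing here is a claim about the Yang–Mills mass gap

THE POINT (WORD-94∕95 of the cell bus; dag-n06-l's chart `B9C2LettersTorusY` ✓ and generic letter `B9C2LettersRealSymm.c2LettersOfRawY` ✓ are IN THE
TREE and generic in the weights `w : IBondY i → ℂ`; their module docstring points HERE for the scalar).  [B9] p. 421 puts into the quadratic form
(3.127) `A ↦ ½⟨A, ΔA⟩ − ⟨HC⁽²⁾(A), J⟩` a function `C⁽²⁾(A)` on the bonds of `𝔅` which «on `Λ_j` coincides with `C_j⁽²⁾(LʲηA)` — a second order term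
in the expansion of `Q_j(ηA)`» when `H` solves (3.109)–(3.110), and which «equals `Lʲη·C_j⁽²⁾(A)` on `Λ_j`» when `H` is given by (3.126).  def-Y's
`H` IS (3.126)'s (`B9Eq3132SectDLetters.HDY = G Q* (QGQ*)⁻¹`, `QY_comp_HDY : Q ∘ H = 1`, i.e. it solves `Q(U)A = B`, not `LʲηQ_j(U)A = B`; cf.
p. 422: «these inequalities are for the operator H given by the formula (3.126)»), so THE SECOND READING APPLIES.  This file fixes the one free
datum of n06-l's chart accordingly and pins the resulting letter at the record.

THE DERIVATION OF THE WEIGHT (signed: node00-def-Y, generation 31, 2026-08-30; page-image reads of p. 421 by lit-balaban-r06 (generation 74 crop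
of the two sentences after (3.127): exponent `+1`, argument `A`) and an independent concurring read by lit-lead; (3.14) p. 393 from r06's crop
«`(Lʲη)⁻¹Q_j(U, ηA) = Q_j(U)A + (Lʲη)⁻¹C_j(U, LʲηA)`»).
 (1) VARIABLES.  (3.12) p. 392 expands `A^η(exp(iηA)U)`; def-Y's fine-bond field `A : FBondY i → 𝔸` is that Hermitian-picture `A` (its current
     `JY` is r06's `B9Eq39Adjoint.J` at `η = etaBY i`, (3.11)).  [B7]'s tree letters absorb the `i`: `B7Prop3Flat.expCfg B = e^{B}`,
     `B7Prop4GeneralLevels.logCovIter U B 0 = B` = «`Q₀(U, ηA) = ηA`», so the tree's `B`-variable is `B = iη·A`; `linCovIter` is the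
     un-normalised «`LʲηQ_j(U)A`» and `B7Prop5GeneralInduction.CCovIter = logCovIter − linCovIter`, whence by (3.14)×`Lʲη`
     (`Q_j(U, ηA) = LʲηQ_j(U)A + C_j(U, LʲηA)`):  `CCovIter(U, iηA) = i·C_j(U, LʲηA)`.
 (2) SECOND ORDER.  `B7Eq136SecondOrder.CCovIter2 = ½·d²∕dt² CCovIter(U, tB)|₀` is the quadratic Taylor term and is 2-homogeneous
     (`CCovIter2_ins_smul`), so the second-order term of `Q_j(U, ηA)` is `C_j⁽²⁾(LʲηA) = −i·CCovIter2(U, iηA) = iη²·CCovIter2(U, A)`, and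
     `B7Eq136SecondOrderPeriodic.CCovIter2_perExt_eq_torusPol` gives `CCovIter2(U, A)(c) = ½·P_c(A, A)` with n06-l's `rawPolY i U c = P_c` at RAW
     insertion of def-Y's `A` (`rawPolY_apply`: `torusPol … (fieldY A) (fieldY A′)`).
 (3) THE `Lʲη`.  With (3.126)'s `H` (ours), `C⁽²⁾(A)|_{Λ_j} = Lʲη·C_j⁽²⁾(A) = (Lʲη)⁻¹·C_j⁽²⁾(LʲηA)` (both readings of the glyph agree by
     2-homogeneity).  Hence, entrywise at an index bond `c` of level `j = j(c)` (`B6Ineq2142KLevelV1.lvl`), with `η = etaBY i`, `L = ℓ + 1`: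
         `C⁽²⁾(U; A, A)(c) = (Lʲη)⁻¹ · iη² · ½ · P_c(A, A) = (iη ∕ (2Lʲ)) · P_c(A, A)`,
     i.e. in n06-l's `rawFormY i w U A A′ c = w c • P_c(A, A′)`:  **`w c = iη ∕ (2L^{j(c)}) = (i∕2)·(Lʲη)_c·L^{−2j(c)} = (iη²∕2)·((Lʲη)_c)⁻¹`**
     (`wC2OfRecord`, `wC2OfRecord_eq_len`, `wC2OfRecord_eq_inv_len`; `(Lʲη)_c = (geo9K i).len c`, `B6KLevelCensusIndexV1.len_eq`) — n06-l's
     anticipated shape «`ε·(Lʲη)·L^{−2j}`» with `ε = i∕2`.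
 (4) CHECKS.  (a) (3.136) p. 422: `Δ⁽²⁾A = Σ_j Σ_{b ∈ Λ_j} (Lʲη)^{d+1} tr δ∕δA C_j⁽²⁾(A, b)(H*J)(b)` — `(Lʲη)^d` is the `𝔅`-pairing weight inside
     print's `H*` (def-Y's CONVENTION (C1): `trPairY` ∕ `trAdjY` are the unweighted fine pairings, `trPairY_delta2OfY_trAdj` IS (3.136)) and the
     remaining `(Lʲη)^{+1}` is exactly the factor of (3).  (b) SIGN: linearising the non-linear constraint by `A′ = A − HC⁽²⁾(A)` turns `⟨A′, J⟩`
     into `⟨A, J⟩ − ⟨HC⁽²⁾(A), J⟩`, (3.127)'s «−», iff `C⁽²⁾` is `+` the second-order term — as taken.  (c) PHASE: at a unitary background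
     `CCovIter(U, ·)` maps anti-Hermitian `B` to anti-Hermitian values, so its polarised second derivative is ANTI-real, `P_c(A⋆, A′⋆) = −(P_c(A, A′))⋆`
     (n06-l's `B7Eq136SecondOrderSkewAdjoint`); a PURELY IMAGINARY weight then makes the raw datum real (`rawFormY_wC2OfRecord_apply_star`,
     from `star_wC2OfRecord : (w c)⋆ = −w c`), so in [B7]'s regime n06-l's realification is the identity (`form_eq_raw`) — whereas a REAL weight
     would make the realified letter vanish identically there.  Lean cannot see a wrong modulus (`hC2` is an inequality, `h𝔠real`∕`IsCov` are
     homogeneous): the modulus `η∕(2Lʲ)` rests on (1)–(3) above and is SIGNED here.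
 (5) FOR THE (149) MAJORANT (n06-l's `c2FormMaj_of_torusLetters`, constants theirs): `‖w c‖ = η∕(2L^{j(c)})` (`norm_wC2OfRecord`), so
     `‖w c‖·L^{2j(c)} = ½(Lʲη)_c` (`norm_wC2OfRecord_mul_sq`): their budget `‖w c‖·C₃·L^{2j}·L^{−j(d+1)}e^{2δ(ℓ+3)}e^{−δ·dist} ≤ w_C(c)·κ_C·e^{−δ·dist}`
     closes with `w_C = len·n⁻¹`, `κ_C = ½C₃e^{2δ(ℓ+4)}` as they announced.

WHAT THIS FILE PROVES (all by `rfl`, one-line algebra, or BY NAME from `B9C2LettersRealSymm`, `Node00.OpsYDelta2FormP`, `Node00.OpsYSectDReal`,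
`Node00.OpsYDelta2Form`, `Node00.OpsYD2JForm`).  §1 the weight `wC2OfRecord i` and its faces (`_apply`, `norm_`, `star_`, `_eq_len`, `_eq_inv_len`,
positivity, `‖w c‖ ≤ η∕2`).  §2 the letter at an index over a general fibre `𝔸`: `c2LettersYOfRecord 𝔸 i := c2LettersOfRawY i (rawFormY i (wC2OfRecord i))`,
its form (`rfl`), ★★ reality for EVERY `U` with NO hypothesis (`c2LettersYOfRecord_form_apply_star`, n06-l's `form_apply_star`), symmetry, the regime
face `form U = rawFormY …` (`form_eq_raw`) and the entry formula `form U A A′ c = w c • P_c(A, A′)` there, the raw-reality lemma of (4c).  §3 AT THE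
RECORD (`𝔸 := M_N(ℂ)`): `c2YOfRecord N θ M⋆ : C2Y N θ M⋆`, ★★★ the N06 certificate's displayed `h𝔠real` AS A THEOREM with nothing displayed
(`c2YOfRecord_real_SU` — the `SU(N)` guard is not even used), hence its `hΔ2` with nothing displayed in BOTH currencies
(`resYOfC2P_c2YOfRecord_Δ2_isSymmTr_SU`, `resYOfC2_c2YOfRecord_Δ2_isSymmTr_SU`; unitary-background and `IsRealOpY` forms; the v4 letters'
`GD ∧ G₁ ∧ GG` symmetric at `𝔯 := resYOfC2 (c2YOfRecord)`), the named residual families `resYOfRecordE` ∕ `resYOfRecordP` (`rfl`), and (3.34)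
two bookkeeping theorems displaying `hC : (c2YOfRecord N θ M⋆).IsCov` — VACUOUS AS DISPLAYED for this letter, see EDITION 2.  §4 the v9 instance `opsYOfRecordV9E N θ M⋆ 𝔡₂ 𝔢₀ 𝔴 𝔈 := opsYOfRecordV8E N θ M⋆ (c2YOfRecord N θ M⋆) 𝔡₂ 𝔢₀ 𝔴 𝔈`
with every v8∕v7∕v6∕v4 face (`rfl`).  CONSUMER RECIPE (N06 pair certificate over `opsYNuStOfRecordV4PE … 𝔯 …`): `𝔠 := c2YOfRecord N θ.toStage3Params M⋆`,
`h𝔠real := c2YOfRecord_real_SU N θ.toStage3Params M⋆` (or `h𝔯 : 𝔯 = resYOfRecordP N θ.toStage3Params M⋆`), `hΔ2 := resYOfC2P_c2YOfRecord_Δ2_isSymmTr_SU …`.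

§5 (EDITION 2) the covariance law the letter of record DOES satisfy, BY NAME from dag-n06-l's `B9C2LettersTorusYCov.form_gauge_of_unitary`:
for every gauge function `u` with values in `U(𝔸)` and EVERY background, `C⁽²⁾(U^u; R(u)A, R(u)A′)(c) = R(u(corner of B^{j(c)}(c₋))) C⁽²⁾(U; A, A′)(c)`
(`c2LettersYOfRecord_form_gauge_of_unitary`, entrywise `_apply_`, at the record `c2YOfRecord_form_gauge_of_unitary` and the certificate-typed
`c2YOfRecord_form_gauge_SU`), packaged as the displayable Prop `C2LettersY.IsCovUC` ∕ `C2Y.IsCovUC` (corner-keyed, unitary-restricted) with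
`c2LettersYOfRecord_isCovUC`, ★★★ `c2YOfRecord_isCovUC`, the flat instances, and `…_of_keys` (where corner and centre readings of `u` agree the corner law is
the `IsCov`-keyed law).

EDITION 2 (node00-def-Y, generation 31, 2026-08-30) — ERRATUM ON THE DISPLAYED `IsCov` (LOCATED by dag-n06-l, generation 34; ACCEPTED).  Edition 1 wrote
«the gauge covariance `(c2YOfRecord N θ M⋆).IsCov` … is DISPLAYED, not proved — dag-n06-l's announced sequel».  THAT SENTENCE IS WITHDRAWN:
`C2LettersY.IsCov` (`Node00.OpsYDelta2Form`) reads the gauge function at `gIBondY g c = g (embIter j c₋)` — the ITERATED CENTRE of `Setup.emb` (RG1 p. 251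
convention; `Setup`'s DIVERGENCE F3: «B5∕B7's corner convention would be n ↦ nL») — and quantifies over ALL invertible `g`, whereas [5]'s `C_j⁽²⁾` as typed
in the tree's B7 chain (`B7AvgGaugeCovariance.uLev L u j z = u(Lʲz)`, dag-n06-w3's `B9Eq332FieldAvgCovariance.logCovIter_rot ∕ linCovIter_rot`), hence
`c2YOfRecord`, transforms with `u` read at the CORNER of the block `B^{j(c)}(c₋)` (`B9C2LettersTorusYCov.srcCornerY ∕ gSrcCornerY`) — a different site for
`L ≥ 3` — and the REALIFIED letter is covariant for UNITARY-valued `u` only (`(R(u)a)⋆ = R(u)a⋆` iff `u⋆ = u⁻¹`).  So `(c2YOfRecord N θ M⋆).IsCov` is NOT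
expected to be inhabitable, and the two Edition-1 theorems displaying `hC : (c2YOfRecord N θ M⋆).IsCov` (`resYOfC2P_c2YOfRecord_Δ2_isCovBondOpY`,
`resYOfC2_c2YOfRecord_Δ2_isCovBondOpY`) are VACUOUS AS DISPLAYED for this letter; they are kept unchanged (edition rule; `IsCov` remains the right law
for centre-keyed letters — the flat letter, anything generated from def-Y's `QY`) and flagged in their docstrings.  The law that HOLDS is §5.
HONESTY — TWO CONTOUR SYSTEMS IN ONE RECORD: def-Y's `QY` ∕ `parBY` ∕ `HDY` are centre-keyed (`QY_cov`, `HDY_cov` at `gIBondY`), [5]'s `C_j⁽²⁾` of record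
is corner-keyed; CONSEQUENCE, stated plainly: the record's `Δ⁽²⁾(U) = 2ρ⟨HC⁽²⁾, J⟩` ((3.134)) is NOT asserted gauge-covariant as typed.  This is HARMLESS
for every consumer in the tree — the N06 certificate (VO ∕ VQ) and dag-n06-l's (149) majorant use `C⁽²⁾` only through the (3.136)–(3.137) norms, reality and
symmetry (nothing proved is affected; `rg`: no `Summits` importer of `IsCov` ∕ `IsCovBondOpY`) — and the repair, should a covariant record ever be CONSUMED,
is ONE definition (conjugate `C⁽²⁾(U; ·, ·)(c)` by the `U`-transporter centre → corner of `B(c₋)`, unitary at unitary backgrounds, so every norm ∕ reality ∕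
symmetry statement survives verbatim; or re-key `QY` to the corner); it is deliberately NOT made here (no consumer; it would churn the folded N06 editions).

NOT CLAIMED HERE.  `(c2YOfRecord N θ M⋆).IsCov` is NOT claimed (and not expected, above); NO non-inhabitability theorem is proved either (it would need a
non-commuting value of `P_c`, i.e. a computation inside `CCovIter2` — not attempted); the regime hypotheses of `form_eq_raw` (symmetry and anti-reality of `P_c` at the backgrounds of the certificate's
class) are n06-l's `B9C2FormBoxRegimeY` ∕ `B7Eq136SecondOrderSkewAdjoint` business and enter only as hypotheses; the (149) majorant `hC2` is theirs;
the identification of def-Y's `QY` with [B7]'s `k`-fold averaging composite underlying (1) is the standing dictionary of `Node00.OpsYSectD` and is not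
re-derived; nothing here is a claim about the Yang–Mills mass gap.
-/

noncomputable section

namespace Literature.MathematicalPhysics.QuantumFieldTheory.Balaban1983to89.Node00

open B6KLevelCensusIndexV1 (KIdx)
open B9PinMembersKLevelV1 (MemberY geo9Y)
open B6Ineq2142KLevelV1 (lvl)
open B9GeoNormsKLevelV1 (geo9K geo9K_len_kGeo)
open B9Thm311ReadingCoords (IsSymmTr)
open B7Prop2SpecialUnitary (specialUnitaryUnits specialUnitaryUnits_le_unitaryUnits)
open B9C2LettersTorusY (rawPolY rawFormY rawFormY_apply)
open B9C2LettersRealSymm (c2LettersOfRawY realPart symmPart form_apply_star form_eq_raw form_apply_of_symm)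
open B9C2LettersTorusYCov (srcCornerY gSrcCornerY form_gauge_of_unitary)
open B7Prop2Explicit (unitaryUnits)
open B9Eq39Adjoint (R)
open scoped Matrix ComplexConjugate
open scoped Matrix.Norms.L2Operator

/-! ## §1 The derived scale weight `w(c) = iη ∕ (2L^{j(c)})` -/

section Weight

variable {d ℓ : ℕ} {hd : 1 ≤ d + 1} {hL : Odd (ℓ + 1) ∧ 1 < ℓ + 1} {b₀ b₁ : ℝ} (i : KIdx d ℓ hd hL b₀ b₁)

/-- ★★★ **THE SCALE WEIGHT OF RECORD** `w(c) = i·η ∕ (2·L^{j(c)})` (`η = etaBY i = |c_f|⁻¹`, `L = ℓ + 1`, `j(c)` the level of the index bond `c`):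
the scalar turning n06-l's raw datum `w c • P_c(A, A′)` into print's `C⁽²⁾(U; A, A′)(c) = Lʲη·C_j⁽²⁾(A)` of p. 421 for `H` of (3.126) — see the module
docstring, THE DERIVATION (1)–(4). [cite: Balaban1985BackgroundPropagators, p.421 (after (3.127)), (3.126) p.420, (3.14) p.393, (3.12) p.392]
[cite: Balaban1985Averaging, (136) p.39, (109) p.34] -/
def wC2OfRecord : IBondY i → ℂ := fun c => ((etaBY i / (2 * (((ℓ + 1 : ℕ) : ℝ)) ^ lvl i.hN i.D i.hk c) : ℝ) : ℂ) * Complex.I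

/-- the weight, evaluated. [cite: Balaban1985BackgroundPropagators, p.421, bookkeeping] -/
theorem wC2OfRecord_apply (c : IBondY i) :
    wC2OfRecord i c = ((etaBY i / (2 * (((ℓ + 1 : ℕ) : ℝ)) ^ lvl i.hN i.D i.hk c) : ℝ) : ℂ) * Complex.I := rfl

/-- the real modulus `η ∕ (2L^{j(c)})` is positive. [cite: Balaban1985BackgroundPropagators, p.389 (T_η), bookkeeping] -/
theorem wC2OfRecord_modulus_pos (c : IBondY i) : 0 < etaBY i / (2 * (((ℓ + 1 : ℕ) : ℝ)) ^ lvl i.hN i.D i.hk c) :=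
  div_pos (inv_pos.mpr (abs_pos.mpr i.hcf)) (mul_pos two_pos (pow_pos (Nat.cast_pos.mpr (Nat.succ_pos ℓ)) _))

/-- ★ `‖w(c)‖ = η ∕ (2L^{j(c)})`. [cite: Balaban1985BackgroundPropagators, p.421, (3.136) p.422, bookkeeping] -/
theorem norm_wC2OfRecord (c : IBondY i) : ‖wC2OfRecord i c‖ = etaBY i / (2 * (((ℓ + 1 : ℕ) : ℝ)) ^ lvl i.hN i.D i.hk c) := by
  rw [wC2OfRecord_apply, norm_mul, Complex.norm_I, mul_one, Complex.norm_real, Real.norm_of_nonneg (wC2OfRecord_modulus_pos i c).le]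

/-- `‖w(c)‖ ≤ η ∕ 2` (`L^{j(c)} ≥ 1`). [cite: Balaban1985BackgroundPropagators, p.421, bookkeeping] -/
theorem norm_wC2OfRecord_le (c : IBondY i) : ‖wC2OfRecord i c‖ ≤ etaBY i / 2 := by
  rw [norm_wC2OfRecord]
  have hη : 0 < etaBY i := inv_pos.mpr (abs_pos.mpr i.hcf)
  have hL : (1 : ℝ) ≤ (((ℓ + 1 : ℕ) : ℝ)) ^ lvl i.hN i.D i.hk c := one_le_pow₀ (by exact_mod_cast Nat.succ_le_succ (Nat.zero_le ℓ))
  exact div_le_div_of_nonneg_left hη.le two_pos (by linarith)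

/-- ★ **THE WEIGHT IS PURELY IMAGINARY**: `(w c)⋆ = −w c` (THE DERIVATION (4c): this is what makes the raw datum real in [B7]'s regime).
[cite: Balaban1985Averaging, p.20 («A ∈ 𝔤»), (22)–(23) p.21] [cite: Balaban1985BackgroundPropagators, p.421] -/
theorem star_wC2OfRecord (c : IBondY i) : star (wC2OfRecord i c) = -wC2OfRecord i c := by
  rw [wC2OfRecord_apply, ← starRingEnd_apply, map_mul, Complex.conj_ofReal, Complex.conj_I, mul_neg]

/-- ★ **PRINT's SHAPE** `w(c) = (iη²∕2)·((Lʲη)_c)⁻¹` — the level-free second-order constant `iη²∕2` of `C_j⁽²⁾(LʲηA) = iη²·CCovIter2(U, A)` times p. 421's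
`(Lʲη)⁻¹` (`(Lʲη)_c = (geo9K i).len c = L^{j(c)}∕|c_f|`). [cite: Balaban1985BackgroundPropagators, p.421 (after (3.127)), p.422 («additional factor (Lʲη)⁻¹»)] -/
theorem wC2OfRecord_eq_inv_len (c : IBondY i) :
    wC2OfRecord i c = (Complex.I * ((etaBY i : ℝ) : ℂ) ^ 2 / 2) * ((((geo9K i).len c : ℝ) : ℂ))⁻¹ := by
  have hlen : (geo9K i).len c = (((ℓ + 1 : ℕ) : ℝ)) ^ (lvl i.hN i.D i.hk c) / |i.cf| := by
    rw [geo9K_len_kGeo]; exact B6KLevelCensusIndexV1.len_eq i c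
  have hcf : (|i.cf| : ℝ) ≠ 0 := abs_ne_zero.mpr i.hcf
  have hLj : (((ℓ + 1 : ℕ) : ℝ)) ^ (lvl i.hN i.D i.hk c) ≠ 0 := pow_ne_zero _ (Nat.cast_ne_zero.mpr (Nat.succ_ne_zero ℓ))
  rw [wC2OfRecord_apply, hlen]
  simp only [etaBY]
  have hcf' : ((|i.cf| : ℝ) : ℂ) ≠ 0 := Complex.ofReal_ne_zero.mpr hcf
  have hLj' : (((((ℓ + 1 : ℕ) : ℝ)) ^ (lvl i.hN i.D i.hk c) : ℝ) : ℂ) ≠ 0 := Complex.ofReal_ne_zero.mpr hLj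
  push_cast at hcf' hLj' ⊢
  field_simp

/-- ★ **n06-l's ANTICIPATED SHAPE** `w(c) = (i∕2)·(Lʲη)_c·L^{−2j(c)}` («`ε·(Lʲη)·L^{−2j}`» with `ε = i∕2`).
[cite: Balaban1985BackgroundPropagators, p.421, (3.136) p.422] [cite: Balaban1985Averaging, (149) p.40] -/
theorem wC2OfRecord_eq_len (c : IBondY i) :
    wC2OfRecord i c = (Complex.I / 2) * ((((geo9K i).len c * (((((ℓ + 1 : ℕ) : ℝ)) ^ lvl i.hN i.D i.hk c)⁻¹) ^ 2 : ℝ) : ℂ)) := by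
  have hlen : (geo9K i).len c = (((ℓ + 1 : ℕ) : ℝ)) ^ (lvl i.hN i.D i.hk c) / |i.cf| := by
    rw [geo9K_len_kGeo]; exact B6KLevelCensusIndexV1.len_eq i c
  have hcf : (|i.cf| : ℝ) ≠ 0 := abs_ne_zero.mpr i.hcf
  have hLj : (((ℓ + 1 : ℕ) : ℝ)) ^ (lvl i.hN i.D i.hk c) ≠ 0 := pow_ne_zero _ (Nat.cast_ne_zero.mpr (Nat.succ_ne_zero ℓ))
  rw [wC2OfRecord_apply, hlen]
  simp only [etaBY]
  have hcf' : ((|i.cf| : ℝ) : ℂ) ≠ 0 := Complex.ofReal_ne_zero.mpr hcf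
  have hLj' : (((((ℓ + 1 : ℕ) : ℝ)) ^ (lvl i.hN i.D i.hk c) : ℝ) : ℂ) ≠ 0 := Complex.ofReal_ne_zero.mpr hLj
  push_cast at hcf' hLj' ⊢
  field_simp

/-- ★ **THE (149)-BUDGET FACE**: `‖w(c)‖·(L^{j(c)})² = ½(Lʲη)_c` (so n06-l's majorant weight is `w_C = len·n⁻¹` with `κ_C = ½C₃e^{2δ(ℓ+4)}`).
[cite: Balaban1985Averaging, (149) p.40] [cite: Balaban1985BackgroundPropagators, (3.136)–(3.137) p.422] -/
theorem norm_wC2OfRecord_mul_sq (c : IBondY i) :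
    ‖wC2OfRecord i c‖ * ((((ℓ + 1 : ℕ) : ℝ)) ^ lvl i.hN i.D i.hk c) ^ 2 = (geo9K i).len c / 2 := by
  have hlen : (geo9K i).len c = (((ℓ + 1 : ℕ) : ℝ)) ^ (lvl i.hN i.D i.hk c) / |i.cf| := by
    rw [geo9K_len_kGeo]; exact B6KLevelCensusIndexV1.len_eq i c
  have hcf : (|i.cf| : ℝ) ≠ 0 := abs_ne_zero.mpr i.hcf
  have hLj : (((ℓ + 1 : ℕ) : ℝ)) ^ (lvl i.hN i.D i.hk c) ≠ 0 := pow_ne_zero _ (Nat.cast_ne_zero.mpr (Nat.succ_ne_zero ℓ))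
  rw [norm_wC2OfRecord, hlen]
  simp only [etaBY]
  field_simp

/-- the (149)-budget face at a pinned member (`geo9Y x = geo9K x.toKIdx`). [cite: Balaban1985Averaging, (149) p.40, bookkeeping] -/
theorem norm_wC2OfRecord_mul_sq_member {Mstar : ℕ} (x : MemberY d ℓ hd hL b₀ b₁ Mstar) (c : IBondY x.toKIdx) :
    ‖wC2OfRecord x.toKIdx c‖ * ((((ℓ + 1 : ℕ) : ℝ)) ^ lvl x.hN x.D x.hk c) ^ 2 = (geo9Y x).len c / 2 :=
  norm_wC2OfRecord_mul_sq x.toKIdx c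

end Weight

/-! ## §2 The letter of record at an index, over a general fibre algebra -/

section Letter

variable {d ℓ : ℕ} {hd : 1 ≤ d + 1} {hL : Odd (ℓ + 1) ∧ 1 < ℓ + 1} {b₀ b₁ : ℝ}
variable (𝔸 : Type) [NormedRing 𝔸] [NormedAlgebra ℂ 𝔸] [CompleteSpace 𝔸] [StarRing 𝔸] [StarModule ℂ 𝔸]
variable (i : KIdx d ℓ hd hL b₀ b₁)

/-- ★★★ **[5]'s FORM LETTER `C⁽²⁾` OF RECORD at an index**: n06-l's real-symmetric letter generated (`c2LettersOfRawY`) by their raw torus datum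
`rawFormY i w` AT THE DERIVED WEIGHT `w := wC2OfRecord i` — `form U = Re Sym (A, A′ ↦ (c ↦ w(c)·P_c(A, A′)))`.
[cite: Balaban1985BackgroundPropagators, p.421 (after (3.127)), (3.134) p.422] [cite: Balaban1985Averaging, (136) p.39] [cite: Balaban1985Variational, (56) p.286] -/
def c2LettersYOfRecord : C2LettersY 𝔸 i := c2LettersOfRawY i (rawFormY i (wC2OfRecord i))

/-- the letter of record is the generated letter at the derived weight. [cite: Balaban1985BackgroundPropagators, (3.134) p.422, bookkeeping] -/
theorem c2LettersYOfRecord_eq : c2LettersYOfRecord 𝔸 i = c2LettersOfRawY i (rawFormY i (wC2OfRecord i)) := rfl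

/-- its form: `form U = Re (Sym (rawFormY i w U))`. [cite: Balaban1985BackgroundPropagators, (3.134) p.422, bookkeeping] -/
theorem c2LettersYOfRecord_form (U : CfgY 𝔸 i) : (c2LettersYOfRecord 𝔸 i).form U = realPart (symmPart (rawFormY i (wC2OfRecord i) U)) := rfl

/-- ★★ **REALITY FOR EVERY BACKGROUND, NO HYPOTHESIS**: `C⁽²⁾(U; A⋆, A′⋆) = C⁽²⁾(U; A, A′)⋆`. [cite: Balaban1985Averaging, p.20 («A ∈ 𝔤»), (22)–(23) p.21]
[cite: Balaban1985BackgroundPropagators, (3.134) p.422] -/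
theorem c2LettersYOfRecord_form_apply_star (U : CfgY 𝔸 i) (A A' : FBondY i → 𝔸) :
    (c2LettersYOfRecord 𝔸 i).form U (star A) (star A') = star ((c2LettersYOfRecord 𝔸 i).form U A A') :=
  form_apply_star i _ U A A'

/-- symmetry for every background (the `C2LettersY` axiom). [cite: Balaban1985BackgroundPropagators, (3.134) p.422, bookkeeping] -/
theorem c2LettersYOfRecord_form_symm (U : CfgY 𝔸 i) (A A' : FBondY i → 𝔸) :
    (c2LettersYOfRecord 𝔸 i).form U A A' = (c2LettersYOfRecord 𝔸 i).form U A' A :=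
  (c2LettersYOfRecord 𝔸 i).symm U A A'

/-- ★ **IN THE REGIME THE LETTER IS THE RAW DATUM**: where `rawFormY i w U` is symmetric and real, `form U = rawFormY i w U`.
[cite: Balaban1985Variational, (56) p.286] [cite: Balaban1985Averaging, (22)–(23) p.21] -/
theorem c2LettersYOfRecord_form_eq_raw {U : CfgY 𝔸 i}
    (hs : ∀ A A', rawFormY i (wC2OfRecord i) U A A' = rawFormY i (wC2OfRecord i) U A' A)
    (hr : ∀ A A', rawFormY i (wC2OfRecord i) U (star A) (star A') = star (rawFormY i (wC2OfRecord i) U A A')) :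
    (c2LettersYOfRecord 𝔸 i).form U = rawFormY i (wC2OfRecord i) U :=
  form_eq_raw i _ hs hr

/-- ★ **THE ENTRY FORMULA IN THE REGIME**: `C⁽²⁾(U; A, A′)(c) = w(c)·P_c(A, A′) = (iη∕(2L^{j(c)}))·P_c(A, A′)`.
[cite: Balaban1985BackgroundPropagators, p.421 (after (3.127))] [cite: Balaban1985Averaging, (136) p.39] -/
theorem c2LettersYOfRecord_form_apply_of_regime {U : CfgY 𝔸 i}
    (hs : ∀ A A', rawFormY i (wC2OfRecord i) U A A' = rawFormY i (wC2OfRecord i) U A' A)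
    (hr : ∀ A A', rawFormY i (wC2OfRecord i) U (star A) (star A') = star (rawFormY i (wC2OfRecord i) U A A'))
    (A A' : FBondY i → 𝔸) (c : IBondY i) :
    (c2LettersYOfRecord 𝔸 i).form U A A' c = wC2OfRecord i c • rawPolY i U c A A' := by
  rw [c2LettersYOfRecord_form_eq_raw 𝔸 i hs hr, rawFormY_apply]

/-- at a symmetric raw datum the entries are `½(w(c)·P_c(A, A′) + (w(c)·P_c(A⋆, A′⋆))⋆)`. [cite: Balaban1985Variational, (56) p.286, bookkeeping] -/
theorem c2LettersYOfRecord_form_apply_of_symm {U : CfgY 𝔸 i}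
    (hs : ∀ A A', rawFormY i (wC2OfRecord i) U A A' = rawFormY i (wC2OfRecord i) U A' A) (A A' : FBondY i → 𝔸) :
    (c2LettersYOfRecord 𝔸 i).form U A A' =
      (2 : ℂ)⁻¹ • (rawFormY i (wC2OfRecord i) U A A' + star (rawFormY i (wC2OfRecord i) U (star A) (star A'))) :=
  form_apply_of_symm i _ hs A A'

variable {𝔸}

/-- ★ **IMAGINARY WEIGHT × ANTI-REAL POLARISATION = REAL RAW DATUM** (THE DERIVATION (4c)): at an entry where `P_c(A⋆, A′⋆) = −(P_c(A, A′))⋆` the raw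
datum commutes with the adjoint. [cite: Balaban1985Averaging, p.20 («A ∈ 𝔤»), (22)–(23) p.21, (136) p.39] [cite: Balaban1985BackgroundPropagators, p.421] -/
theorem rawFormY_wC2OfRecord_apply_star {U : CfgY 𝔸 i} {c : IBondY i} (A A' : FBondY i → 𝔸)
    (hP : rawPolY i U c (star A) (star A') = -star (rawPolY i U c A A')) :
    rawFormY i (wC2OfRecord i) U (star A) (star A') c = star (rawFormY i (wC2OfRecord i) U A A' c) := by
  simp only [rawFormY_apply, hP, star_smul, star_wC2OfRecord, smul_neg, neg_smul]

/-- … hence the raw datum is real wherever every `P_c` is anti-real. [cite: Balaban1985Averaging, (22)–(23) p.21, bookkeeping] -/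
theorem rawFormY_wC2OfRecord_real {U : CfgY 𝔸 i}
    (hP : ∀ (c : IBondY i) (A A' : FBondY i → 𝔸), rawPolY i U c (star A) (star A') = -star (rawPolY i U c A A'))
    (A A' : FBondY i → 𝔸) :
    rawFormY i (wC2OfRecord i) U (star A) (star A') = star (rawFormY i (wC2OfRecord i) U A A') :=
  funext fun c => rawFormY_wC2OfRecord_apply_star i A A' (hP c A A')

end Letter

/-! ## §3 At the record: `𝔸 := M_N(ℂ)`, the certificate's `h𝔠real` and `hΔ2` with nothing displayed, covariance displayed -/

section Record

variable (N : ℕ) (θ : Stage3Params) (Mstar : ℕ)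

/-- ★★★ **THE FAMILY `C⁽²⁾` OF RECORD** of Stage 3′(Y): member by member the letter of record at the trace fibre `M_N(ℂ)` — the pin `𝔠 := c2YOfRecord N θ M⋆`
of the N06 certificate's free form-letter datum. [cite: Balaban1985BackgroundPropagators, p.421 (after (3.127)), (3.134) p.422] [cite: Balaban1985Averaging, (136) p.39] -/
def c2YOfRecord : C2Y N θ Mstar := fun x => c2LettersYOfRecord (Matrix (Fin N) (Fin N) ℂ) x.toKIdx

/-- `c2YOfRecord`, member by member. [cite: Balaban1985BackgroundPropagators, (3.134) p.422, bookkeeping] -/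
theorem c2YOfRecord_apply (x : MemberY θ.d₆ θ.ℓ₆ θ.hd' θ.hL' θ.b₀ θ.b₁ Mstar) :
    c2YOfRecord N θ Mstar x = c2LettersOfRawY x.toKIdx (rawFormY x.toKIdx (wC2OfRecord x.toKIdx)) := rfl

/-- its form at a member. [cite: Balaban1985BackgroundPropagators, (3.134) p.422, bookkeeping] -/
theorem c2YOfRecord_form (x : MemberY θ.d₆ θ.ℓ₆ θ.hd' θ.hL' θ.b₀ θ.b₁ Mstar) (U : CfgY (Matrix (Fin N) (Fin N) ℂ) x.toKIdx) :
    (c2YOfRecord N θ Mstar x).form U = realPart (symmPart (rawFormY x.toKIdx (wC2OfRecord x.toKIdx) U)) := rfl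

/-- ★★ reality of the record's `C⁽²⁾(U)` at EVERY background. [cite: Balaban1985Averaging, (22)–(23) p.21] [cite: Balaban1985BackgroundPropagators, (3.134) p.422] -/
theorem c2YOfRecord_form_apply_star (x : MemberY θ.d₆ θ.ℓ₆ θ.hd' θ.hL' θ.b₀ θ.b₁ Mstar) (U : CfgY (Matrix (Fin N) (Fin N) ℂ) x.toKIdx)
    (A A' : FBondY x.toKIdx → Matrix (Fin N) (Fin N) ℂ) :
    (c2YOfRecord N θ Mstar x).form U (star A) (star A') = star ((c2YOfRecord N θ Mstar x).form U A A') :=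
  c2LettersYOfRecord_form_apply_star (Matrix (Fin N) (Fin N) ℂ) x.toKIdx U A A'

/-- ★★★ **THE N06 CERTIFICATE's DISPLAYED BINDER `h𝔠real` AS A THEOREM at `𝔠 := c2YOfRecord N θ M⋆`** — verbatim shape, NOTHING displayed (the `SU(N)`
guard is not used). Consumer: `h𝔠real := c2YOfRecord_real_SU N θ.toStage3Params M⋆`. [cite: Balaban1985Averaging, p.20 («A ∈ 𝔤»), (22)–(23) p.21]
[cite: Balaban1985BackgroundPropagators, (3.134) p.422, p.390 (G ⊂ U(N))] -/
theorem c2YOfRecord_real_SU :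
    ∀ (x : MemberY θ.d₆ θ.ℓ₆ θ.hd' θ.hL' θ.b₀ θ.b₁ Mstar) (U : CfgY (Matrix (Fin N) (Fin N) ℂ) x.toKIdx),
      (∀ μ z, U μ z ∈ specialUnitaryUnits (Fin N)) →
        ∀ A A' : FBondY x.toKIdx → Matrix (Fin N) (Fin N) ℂ,
          (c2YOfRecord N θ Mstar x).form U (star A) (star A') = star ((c2YOfRecord N θ Mstar x).form U A A') :=
  fun x U _ A A' => c2YOfRecord_form_apply_star N θ Mstar x U A A'

/-- ★ **THE RESIDUAL FAMILY OF RECORD, E-currency** (`H` fed `G′`): `resYOfC2` at the `C⁽²⁾` of record. [cite: Balaban1985BackgroundPropagators, (3.134) p.422, (3.126) p.420] -/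
def resYOfRecordE : ResY N θ Mstar := resYOfC2 N θ Mstar (c2YOfRecord N θ Mstar)

/-- ★ **THE RESIDUAL FAMILY OF RECORD, P-currency** (`H` fed `G′_phys = η²G′`; the N06 certificate's `𝔯`): `resYOfC2P` at the `C⁽²⁾` of record.
Consumer: `h𝔯 : 𝔯 = resYOfRecordP N θ.toStage3Params M⋆`. [cite: Balaban1985BackgroundPropagators, (3.134) p.422, (3.126) p.420] -/
def resYOfRecordP : ResY N θ Mstar := resYOfC2P N θ Mstar (c2YOfRecord N θ Mstar)

/-- `resYOfRecordE` unfolds. [cite: Balaban1985BackgroundPropagators, (3.134) p.422, bookkeeping] -/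
theorem resYOfRecordE_eq : resYOfRecordE N θ Mstar = resYOfC2 N θ Mstar (c2YOfRecord N θ Mstar) := rfl

/-- `resYOfRecordP` unfolds. [cite: Balaban1985BackgroundPropagators, (3.134) p.422, bookkeeping] -/
theorem resYOfRecordP_eq : resYOfRecordP N θ Mstar = resYOfC2P N θ Mstar (c2YOfRecord N θ Mstar) := rfl

/-- ★★★ **THE N06 CERTIFICATE's `hΔ2` AS A THEOREM WITH NOTHING DISPLAYED (P-currency)**: at every `SU(N)`-valued background the record's residual
letter `Δ⁽²⁾(U)` fed `G′_phys`, at the `C⁽²⁾` of record, is symmetric for the Hermitian trace pairing.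
[cite: Balaban1985BackgroundPropagators, (3.134) p.422, Thm 3.11 p.416, p.390 (G ⊂ U(N))] -/
theorem resYOfC2P_c2YOfRecord_Δ2_isSymmTr_SU :
    ∀ (x : MemberY θ.d₆ θ.ℓ₆ θ.hd' θ.hL' θ.b₀ θ.b₁ Mstar) (U : CfgY (Matrix (Fin N) (Fin N) ℂ) x.toKIdx),
      (∀ μ z, U μ z ∈ specialUnitaryUnits (Fin N)) → IsSymmTr (fun _ => (1 : ℝ)) ((resYOfC2P N θ Mstar (c2YOfRecord N θ Mstar) x).Δ2 U) :=
  resYOfC2P_Δ2_isSymmTr_SU θ Mstar (c2YOfRecord N θ Mstar) (c2YOfRecord_real_SU N θ Mstar)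

/-- the same over the named family `resYOfRecordP`. [cite: Balaban1985BackgroundPropagators, (3.134) p.422, bookkeeping] -/
theorem resYOfRecordP_Δ2_isSymmTr_SU :
    ∀ (x : MemberY θ.d₆ θ.ℓ₆ θ.hd' θ.hL' θ.b₀ θ.b₁ Mstar) (U : CfgY (Matrix (Fin N) (Fin N) ℂ) x.toKIdx),
      (∀ μ z, U μ z ∈ specialUnitaryUnits (Fin N)) → IsSymmTr (fun _ => (1 : ℝ)) ((resYOfRecordP N θ Mstar x).Δ2 U) :=
  resYOfC2P_c2YOfRecord_Δ2_isSymmTr_SU N θ Mstar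

/-- `Δ⁽²⁾(U)` fed `G′_phys` at the `C⁽²⁾` of record is symmetric at every UNITARY-valued background. [cite: Balaban1985BackgroundPropagators, (3.134) p.422, Thm 3.11 p.416] -/
theorem resYOfC2P_c2YOfRecord_Δ2_isSymmTr (x : MemberY θ.d₆ θ.ℓ₆ θ.hd' θ.hL' θ.b₀ θ.b₁ Mstar) {U : CfgY (Matrix (Fin N) (Fin N) ℂ) x.toKIdx}
    (hU : ∀ μ y, U μ y ∈ B7Prop2Explicit.unitaryUnits (Matrix (Fin N) (Fin N) ℂ)) :
    IsSymmTr (fun _ => (1 : ℝ)) ((resYOfC2P N θ Mstar (c2YOfRecord N θ Mstar) x).Δ2 U) :=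
  resYOfC2P_Δ2_isSymmTr θ Mstar _ x hU (c2YOfRecord_form_apply_star N θ Mstar x U)

/-- … and a real operator there (`IsRealOpY`). [cite: Balaban1985BackgroundPropagators, (3.134) p.422, bookkeeping] -/
theorem resYOfC2P_c2YOfRecord_Δ2_isRealOpY (x : MemberY θ.d₆ θ.ℓ₆ θ.hd' θ.hL' θ.b₀ θ.b₁ Mstar) {U : CfgY (Matrix (Fin N) (Fin N) ℂ) x.toKIdx}
    (hU : ∀ μ y, U μ y ∈ B7Prop2Explicit.unitaryUnits (Matrix (Fin N) (Fin N) ℂ)) :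
    IsRealOpY ((resYOfC2P N θ Mstar (c2YOfRecord N θ Mstar) x).Δ2 U) :=
  resYOfC2P_Δ2_isRealOpY θ Mstar _ x hU (c2YOfRecord_form_apply_star N θ Mstar x U)

/-- the `IsRealOpY` form at `SU(N)`-valued backgrounds (for the consumers of `OpsYSectDReal` §RecordMember). [cite: Balaban1985BackgroundPropagators, (3.134) p.422, bookkeeping] -/
theorem resYOfC2P_c2YOfRecord_Δ2_isRealOpY_SU (x : MemberY θ.d₆ θ.ℓ₆ θ.hd' θ.hL' θ.b₀ θ.b₁ Mstar) {U : CfgY (Matrix (Fin N) (Fin N) ℂ) x.toKIdx}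
    (hU : ∀ μ z, U μ z ∈ specialUnitaryUnits (Fin N)) : IsRealOpY ((resYOfC2P N θ Mstar (c2YOfRecord N θ Mstar) x).Δ2 U) :=
  resYOfC2P_Δ2_isRealOpY_SU θ Mstar _ (c2YOfRecord_real_SU N θ Mstar) x hU

/-- ★★ **`hΔ2` WITH NOTHING DISPLAYED, E-currency**: `Δ⁽²⁾(U)` fed `G′` at the `C⁽²⁾` of record is symmetric at every unitary-valued background.
[cite: Balaban1985BackgroundPropagators, (3.134) p.422, Thm 3.11 p.416] -/
theorem resYOfC2_c2YOfRecord_Δ2_isSymmTr (x : MemberY θ.d₆ θ.ℓ₆ θ.hd' θ.hL' θ.b₀ θ.b₁ Mstar) {U : CfgY (Matrix (Fin N) (Fin N) ℂ) x.toKIdx}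
    (hU : ∀ μ y, U μ y ∈ B7Prop2Explicit.unitaryUnits (Matrix (Fin N) (Fin N) ℂ)) :
    IsSymmTr (fun _ => (1 : ℝ)) ((resYOfC2 N θ Mstar (c2YOfRecord N θ Mstar) x).Δ2 U) :=
  resYOfC2_Δ2_isSymmTr_real θ Mstar _ x hU (c2YOfRecord_form_apply_star N θ Mstar x U)

/-- the E-currency `hΔ2` at `SU(N)`-valued backgrounds, in the certificate's quantifier shape. [cite: Balaban1985BackgroundPropagators, (3.134) p.422, p.390 (G ⊂ U(N))] -/
theorem resYOfC2_c2YOfRecord_Δ2_isSymmTr_SU :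
    ∀ (x : MemberY θ.d₆ θ.ℓ₆ θ.hd' θ.hL' θ.b₀ θ.b₁ Mstar) (U : CfgY (Matrix (Fin N) (Fin N) ℂ) x.toKIdx),
      (∀ μ z, U μ z ∈ specialUnitaryUnits (Fin N)) → IsSymmTr (fun _ => (1 : ℝ)) ((resYOfC2 N θ Mstar (c2YOfRecord N θ Mstar) x).Δ2 U) :=
  fun x _ hU => resYOfC2_c2YOfRecord_Δ2_isSymmTr N θ Mstar x (fun μ z => specialUnitaryUnits_le_unitaryUnits (hU μ z))

/-- … and a real operator (E-currency). [cite: Balaban1985BackgroundPropagators, (3.134) p.422, bookkeeping] -/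
theorem resYOfC2_c2YOfRecord_Δ2_isRealOpY (x : MemberY θ.d₆ θ.ℓ₆ θ.hd' θ.hL' θ.b₀ θ.b₁ Mstar) {U : CfgY (Matrix (Fin N) (Fin N) ℂ) x.toKIdx}
    (hU : ∀ μ y, U μ y ∈ B7Prop2Explicit.unitaryUnits (Matrix (Fin N) (Fin N) ℂ)) :
    IsRealOpY ((resYOfC2 N θ Mstar (c2YOfRecord N θ Mstar) x).Δ2 U) :=
  resYOfC2_Δ2_isRealOpY θ Mstar _ x hU (c2YOfRecord_form_apply_star N θ Mstar x U)

/-- ★★ **EDITION 8's `hsymD` AT THE v4∕v7 RECORD OVER `𝔯 := resYOfC2 (c2YOfRecord)` WITH NOTHING DISPLAYED**: `GD ∧ G₁ ∧ GG` are symmetric at every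
`SU(N)`-valued background. [cite: Balaban1985BackgroundPropagators, Thm 3.11 p.416, (3.134) p.422, (3.153) p.426] -/
theorem lettersYOfRecordV4_symmDG₁GG_c2YOfRecord :
    ∀ (x : MemberY θ.d₆ θ.ℓ₆ θ.hd' θ.hL' θ.b₀ θ.b₁ Mstar) (U : CfgY (Matrix (Fin N) (Fin N) ℂ) x.toKIdx), (∀ μ z, U μ z ∈ specialUnitaryUnits (Fin N)) →
      IsSymmTr (fun _ => (1 : ℝ)) ((lettersYOfRecordV4 N θ Mstar (resYOfC2 N θ Mstar (c2YOfRecord N θ Mstar)) x).GD U) ∧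
        IsSymmTr (fun _ => (1 : ℝ)) ((lettersYOfRecordV4 N θ Mstar (resYOfC2 N θ Mstar (c2YOfRecord N θ Mstar)) x).G₁ U) ∧
          IsSymmTr (fun _ => (1 : ℝ)) ((lettersYOfRecordV4 N θ Mstar (resYOfC2 N θ Mstar (c2YOfRecord N θ Mstar)) x).GG U) :=
  lettersYOfRecordV4_symmDG₁GG_ofC2_real θ Mstar _ (c2YOfRecord_real_SU N θ Mstar)

/-- (3.34)-type covariance of the record's residual letter fed `G′_phys`, with `hC : (c2YOfRecord …).IsCov` DISPLAYED.  EDITION 2 ERRATUM: the displayed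
`hC` is NOT expected to be inhabitable for this letter (centre-keyed `gIBondY`, all invertible `g` — whereas the letter of record is CORNER-keyed and
covariant for UNITARY `g` only, §5 `c2YOfRecord_isCovUC`); VACUOUS AS DISPLAYED, kept as the record's interface for centre-keyed letters (edition rule).
[cite: Balaban1985BackgroundPropagators, (3.34) p.396, (3.134) p.422] [cite: Balaban1985Averaging, (22)–(23) p.21] -/
theorem resYOfC2P_c2YOfRecord_Δ2_isCovBondOpY (hC : (c2YOfRecord N θ Mstar).IsCov) (x : MemberY θ.d₆ θ.ℓ₆ θ.hd' θ.hL' θ.b₀ θ.b₁ Mstar) :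
    IsCovBondOpY x.toKIdx ((resYOfC2P N θ Mstar (c2YOfRecord N θ Mstar) x).Δ2) :=
  resYOfC2P_Δ2_isCovBondOpY N θ Mstar _ hC x

/-- (3.34)-type covariance displayed, E-currency.  EDITION 2 ERRATUM: `hC` NOT expected inhabitable for this letter — VACUOUS AS DISPLAYED (see
`resYOfC2P_c2YOfRecord_Δ2_isCovBondOpY` and §5). [cite: Balaban1985BackgroundPropagators, (3.34) p.396, (3.134) p.422] -/
theorem resYOfC2_c2YOfRecord_Δ2_isCovBondOpY (hC : (c2YOfRecord N θ Mstar).IsCov) (x : MemberY θ.d₆ θ.ℓ₆ θ.hd' θ.hL' θ.b₀ θ.b₁ Mstar) :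
    IsCovBondOpY x.toKIdx ((resYOfC2 N θ Mstar (c2YOfRecord N θ Mstar) x).Δ2) :=
  resYOfC2_Δ2_isCovBondOpY θ Mstar (c2YOfRecord N θ Mstar) hC x

end Record

/-! ## §4 The v9 instance of record: `𝔠` no longer a parameter -/

section Instance

variable (N : ℕ) (θ : Stage3Params) (Mstar : ℕ)

/-- ★★★ **THE v9 INSTANCE OF RECORD** of Stage 3′(Y): the v8 instance `opsYOfRecordV8E` with [5]'s form letter NO LONGER A PARAMETER but the `C⁽²⁾` of
record `c2YOfRecord` (so `H₁`, `Δ⁽²⁾`, `D2J` are now functions of the record alone) — every `opsYOfRecordV8E_…` ∕ `…V7E_…` ∕ `…V6E_…` ∕ `…V4E_…` face applies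
verbatim (`opsYOfRecordV9E_eq`).  Remaining parametric letters: `𝔡₂` ([5]-type `D̃⁽²⁾`), `𝔢₀.Gt2` (3.186), `𝔴`, `𝔈`.
[cite: Balaban1985BackgroundPropagators, Thms 3.1–3.15 pp.397–432, (3.134) p.422, p.421, (3.156) p.428] -/
def opsYOfRecordV9E (𝔡₂ : Dt2Y N θ Mstar) (𝔢₀ : SectEY N θ Mstar) (𝔴 : RWEY N θ Mstar) (𝔈 : ExpsY N θ Mstar) : OpsY N θ Mstar :=
  opsYOfRecordV8E N θ Mstar (c2YOfRecord N θ Mstar) 𝔡₂ 𝔢₀ 𝔴 𝔈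

variable (𝔡₂ : Dt2Y N θ Mstar) (𝔢₀ : SectEY N θ Mstar) (𝔴 : RWEY N θ Mstar) (𝔈 : ExpsY N θ Mstar)

/-- the v9 instance is the v8 instance at the `C⁽²⁾` of record. [cite: Balaban1985BackgroundPropagators, (3.134) p.422, bookkeeping] -/
theorem opsYOfRecordV9E_eq : opsYOfRecordV9E N θ Mstar 𝔡₂ 𝔢₀ 𝔴 𝔈 = opsYOfRecordV8E N θ Mstar (c2YOfRecord N θ Mstar) 𝔡₂ 𝔢₀ 𝔴 𝔈 := rfl

/-- … the v7 instance at the `C⁽²⁾` of record and the re-issued Sect. E letters. [cite: Balaban1985BackgroundPropagators, (3.156) p.428, bookkeeping] -/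
theorem opsYOfRecordV9E_eq_V7E :
    opsYOfRecordV9E N θ Mstar 𝔡₂ 𝔢₀ 𝔴 𝔈 =
      opsYOfRecordV7E N θ Mstar (c2YOfRecord N θ Mstar) (sectEYWithDt2 N θ Mstar (resYOfC2 N θ Mstar (c2YOfRecord N θ Mstar)) 𝔡₂ 𝔢₀) 𝔴 𝔈 := rfl

/-- … the v6 instance at the residual family of record and the re-issued letters. [cite: Balaban1985BackgroundPropagators, (3.134) p.422, (3.156) p.428, bookkeeping] -/
theorem opsYOfRecordV9E_eq_V6E :
    opsYOfRecordV9E N θ Mstar 𝔡₂ 𝔢₀ 𝔴 𝔈 =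
      opsYOfRecordV6E N θ Mstar (resYOfC2 N θ Mstar (c2YOfRecord N θ Mstar))
        (sectEYWithDt2 N θ Mstar (resYOfC2 N θ Mstar (c2YOfRecord N θ Mstar)) 𝔡₂ 𝔢₀) 𝔴 𝔈 := rfl

/-- … and the v4 instance at the v6 Sect. E letters of the re-issued letters (the shape the N06 certificates are stated at).
[cite: Balaban1985BackgroundPropagators, (3.157) p.428, bookkeeping] -/
theorem opsYOfRecordV9E_eq_V4E :
    opsYOfRecordV9E N θ Mstar 𝔡₂ 𝔢₀ 𝔴 𝔈 =
      opsYOfRecordV4E N θ Mstar (resYOfC2 N θ Mstar (c2YOfRecord N θ Mstar))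
        (sectEYOfRecordV6 N θ Mstar (sectEYWithDt2 N θ Mstar (resYOfC2 N θ Mstar (c2YOfRecord N θ Mstar)) 𝔡₂ 𝔢₀)) 𝔴 𝔈 := rfl

/-- the v4 face over the named residual family of record `resYOfRecordE`. [cite: Balaban1985BackgroundPropagators, (3.157) p.428, bookkeeping] -/
theorem opsYOfRecordV9E_eq_V4E_resYOfRecordE :
    opsYOfRecordV9E N θ Mstar 𝔡₂ 𝔢₀ 𝔴 𝔈 =
      opsYOfRecordV4E N θ Mstar (resYOfRecordE N θ Mstar)
        (sectEYOfRecordV6 N θ Mstar (sectEYWithDt2 N θ Mstar (resYOfRecordE N θ Mstar) 𝔡₂ 𝔢₀)) 𝔴 𝔈 := rfl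

/-- the v9 instance's rows 24′∕25 letters ARE the v4 ones at the record's residual family (so FILE 20 §7 ∕ FILE 21 apply through `opsYOfRecordV4E_letters`).
[cite: Balaban1985BackgroundPropagators, Thms 3.1–3.15 pp.397–432, bookkeeping] -/
theorem opsYOfRecordV9E_letters (x : MemberY θ.d₆ θ.ℓ₆ θ.hd' θ.hL' θ.b₀ θ.b₁ Mstar) :
    (opsYOfRecordV9E N θ Mstar 𝔡₂ 𝔢₀ 𝔴 𝔈 x).P349 =
        (opsYOfRecordV4E N θ Mstar (resYOfC2 N θ Mstar (c2YOfRecord N θ Mstar))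
          (sectEYWithDt2 N θ Mstar (resYOfC2 N θ Mstar (c2YOfRecord N θ Mstar)) 𝔡₂ 𝔢₀) 𝔴 𝔈 x).P349 ∧
      (opsYOfRecordV9E N θ Mstar 𝔡₂ 𝔢₀ 𝔴 𝔈 x).HasRWExpC =
        (opsYOfRecordV4E N θ Mstar (resYOfC2 N θ Mstar (c2YOfRecord N θ Mstar))
          (sectEYWithDt2 N θ Mstar (resYOfC2 N θ Mstar (c2YOfRecord N θ Mstar)) 𝔡₂ 𝔢₀) 𝔴 𝔈 x).HasRWExpC :=
  opsYOfRecordV8E_letters N θ Mstar (c2YOfRecord N θ Mstar) 𝔡₂ 𝔢₀ 𝔴 𝔈 x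

end Instance

/-! ## §5 EDITION 2 — the covariance law the letter of record DOES satisfy: corner-keyed, unitary gauge functions ([5] (52), [B9] (3.34)) -/

section CovUC

variable {d ℓ : ℕ} {hd : 1 ≤ d + 1} {hL : Odd (ℓ + 1) ∧ 1 < ℓ + 1} {b₀ b₁ : ℝ}
variable {𝔸 : Type} [NormedRing 𝔸] [NormedAlgebra ℂ 𝔸] [CompleteSpace 𝔸] [StarRing 𝔸]

/-- **CORNER-KEYED, UNITARY-RESTRICTED COVARIANCE of a form letter** (dag-n06-l's option (a), the law [5]'s `C_j⁽²⁾` satisfies as typed in the tree):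
for every gauge function `u` with values in `U(𝔸)`, every background and all fields, `C⁽²⁾(U^u; R(u)A, R(u)A′)(c) = R(u(corner of B^{j(c)}(c₋))) C⁽²⁾(U; A, A′)(c)`
— `u` read at `B9C2LettersTorusYCov.gSrcCornerY` (the block CORNER `proj (L^{j(c)}·z(c))`, [B7]'s representative `uLev L u j z = u(Lʲz)`), NOT at `gIBondY`
(`Setup.emb`'s iterated centre) as in `C2LettersY.IsCov`; the two sites differ for `L ≥ 3`, and the restriction to unitary `u` is forced by the realification.
[cite: Balaban1985BackgroundPropagators, (3.34) p.396, (3.12) p.392, (3.134) p.422] [cite: Balaban1985Averaging, (52) p.26, (22)–(23) p.21] -/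
def C2LettersY.IsCovUC {x : KIdx d ℓ hd hL b₀ b₁} (𝔠 : C2LettersY 𝔸 x) : Prop :=
  ∀ (g : GaugeY 𝔸 x), (∀ z, g z ∈ unitaryUnits 𝔸) → ∀ (U : CfgY 𝔸 x) (A A' : FBondY x → 𝔸),
    𝔠.form (gaugeY x g U) (conjY (gBondY x g) A) (conjY (gBondY x g) A') = conjY (gSrcCornerY x g) (𝔠.form U A A')

/-- the flat letter is corner-covariant (nonvacuity of `IsCovUC`). [cite: Balaban1985BackgroundPropagators, (3.34) p.396, bookkeeping] -/
theorem c2LettersY_flat_isCovUC (x : KIdx d ℓ hd hL b₀ b₁) : (c2LettersY_flat 𝔸 x).IsCovUC := fun g _ U A A' => by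
  simp only [c2LettersY_flat_form, LinearMap.zero_apply, map_zero]

variable [StarModule ℂ 𝔸] (i : KIdx d ℓ hd hL b₀ b₁)

/-- ★★ **EVERY GENERATED LETTER `c2LettersOfRawY i (rawFormY i w)` IS CORNER-COVARIANT FOR UNITARY GAUGE FUNCTIONS** — dag-n06-l's
`B9C2LettersTorusYCov.form_gauge_of_unitary`, BY NAME (every weight `w`, every background). [cite: Balaban1985BackgroundPropagators, (3.34) p.396]
[cite: Balaban1985Averaging, (52) p.26, (22)–(23) p.21] -/
theorem c2LettersOfRawY_rawFormY_isCovUC (w : IBondY i → ℂ) : (c2LettersOfRawY i (rawFormY i w) : C2LettersY 𝔸 i).IsCovUC :=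
  fun _ hg U A A' => form_gauge_of_unitary i w hg U A A'

/-- ★★★ **THE LETTER OF RECORD IS CORNER-COVARIANT FOR UNITARY GAUGE FUNCTIONS, AT EVERY BACKGROUND**:
`C⁽²⁾(U^u; R(u)A, R(u)A′) = R(u∘corner) C⁽²⁾(U; A, A′)` for `u : T → U(𝔸)`. [cite: Balaban1985BackgroundPropagators, (3.34) p.396, p.421, (3.134) p.422]
[cite: Balaban1985Averaging, (52) p.26, (22)–(23) p.21, (136) p.39] -/
theorem c2LettersYOfRecord_form_gauge_of_unitary {g : GaugeY 𝔸 i} (hg : ∀ z, g z ∈ unitaryUnits 𝔸) (U : CfgY 𝔸 i) (A A' : FBondY i → 𝔸) :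
    (c2LettersYOfRecord 𝔸 i).form (gaugeY i g U) (conjY (gBondY i g) A) (conjY (gBondY i g) A') =
      conjY (gSrcCornerY i g) ((c2LettersYOfRecord 𝔸 i).form U A A') :=
  form_gauge_of_unitary i (wC2OfRecord i) hg U A A'

/-- the letter of record satisfies `IsCovUC`. [cite: Balaban1985BackgroundPropagators, (3.34) p.396] [cite: Balaban1985Averaging, (52) p.26] -/
theorem c2LettersYOfRecord_isCovUC : (c2LettersYOfRecord 𝔸 i).IsCovUC := c2LettersOfRawY_rawFormY_isCovUC (𝔸 := 𝔸) i (wC2OfRecord i)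

/-- entrywise: `C⁽²⁾(U^u; R(u)A, R(u)A′)(c) = R(u(corner c)) (C⁽²⁾(U; A, A′)(c))`. [cite: Balaban1985BackgroundPropagators, (3.34) p.396, (3.12) p.392]
[cite: Balaban1985Averaging, (52) p.26] -/
theorem c2LettersYOfRecord_form_gauge_apply_of_unitary {g : GaugeY 𝔸 i} (hg : ∀ z, g z ∈ unitaryUnits 𝔸) (U : CfgY 𝔸 i) (A A' : FBondY i → 𝔸)
    (c : IBondY i) :
    (c2LettersYOfRecord 𝔸 i).form (gaugeY i g U) (conjY (gBondY i g) A) (conjY (gBondY i g) A') c =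
      R (g (srcCornerY i c)) ((c2LettersYOfRecord 𝔸 i).form U A A' c) := by
  rw [c2LettersYOfRecord_form_gauge_of_unitary i hg U A A', conjY_apply]
  rfl

/-- **WHERE THE TWO DISPLAYS AGREE**: if the gauge function reads the same at the corner and at the centre of every source block (`gSrcCornerY = gIBondY`
pointwise — e.g. `u` constant on blocks), the corner law IS the `IsCov`-keyed law, for unitary `u`. [cite: Balaban1985BackgroundPropagators, (3.34) p.396, (3.12) p.392, bookkeeping] -/
theorem c2LettersYOfRecord_form_gauge_of_unitary_of_keys {g : GaugeY 𝔸 i} (hg : ∀ z, g z ∈ unitaryUnits 𝔸)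
    (hkey : ∀ c : IBondY i, gSrcCornerY i g c = gIBondY i g c) (U : CfgY 𝔸 i) (A A' : FBondY i → 𝔸) :
    (c2LettersYOfRecord 𝔸 i).form (gaugeY i g U) (conjY (gBondY i g) A) (conjY (gBondY i g) A') =
      conjY (gIBondY i g) ((c2LettersYOfRecord 𝔸 i).form U A A') := by
  rw [c2LettersYOfRecord_form_gauge_of_unitary i hg U A A', show gSrcCornerY i g = gIBondY i g from funext hkey]

variable (N : ℕ) (θ : Stage3Params) (Mstar : ℕ)

/-- `IsCovUC` member by member, for a family of form letters at the record's fibre `M_N(ℂ)`. [cite: Balaban1985BackgroundPropagators, (3.34) p.396, bookkeeping] -/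
def C2Y.IsCovUC (𝔠 : C2Y N θ Mstar) : Prop := ∀ x, (𝔠 x).IsCovUC

/-- the flat family is corner-covariant. [cite: Balaban1985BackgroundPropagators, (3.34) p.396, bookkeeping] -/
theorem c2Y_flat_isCovUC : (c2Y_flat N θ Mstar).IsCovUC := fun x => c2LettersY_flat_isCovUC x.toKIdx

/-- ★★★ **THE FAMILY `C⁽²⁾` OF RECORD IS CORNER-COVARIANT FOR UNITARY GAUGE FUNCTIONS** — the covariance letter the record DOES carry (displayable as
`h𝔠cov : (c2YOfRecord N θ M⋆).IsCovUC`, discharged here with nothing displayed). [cite: Balaban1985BackgroundPropagators, (3.34) p.396, (3.134) p.422]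
[cite: Balaban1985Averaging, (52) p.26, (22)–(23) p.21] -/
theorem c2YOfRecord_isCovUC : (c2YOfRecord N θ Mstar).IsCovUC := fun x => c2LettersYOfRecord_isCovUC x.toKIdx

/-- the record's law at a member, unitary-valued `u`. [cite: Balaban1985BackgroundPropagators, (3.34) p.396, (3.134) p.422] [cite: Balaban1985Averaging, (52) p.26] -/
theorem c2YOfRecord_form_gauge_of_unitary (x : MemberY θ.d₆ θ.ℓ₆ θ.hd' θ.hL' θ.b₀ θ.b₁ Mstar) {g : GaugeY (Matrix (Fin N) (Fin N) ℂ) x.toKIdx}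
    (hg : ∀ z, g z ∈ unitaryUnits (Matrix (Fin N) (Fin N) ℂ)) (U : CfgY (Matrix (Fin N) (Fin N) ℂ) x.toKIdx)
    (A A' : FBondY x.toKIdx → Matrix (Fin N) (Fin N) ℂ) :
    (c2YOfRecord N θ Mstar x).form (gaugeY x.toKIdx g U) (conjY (gBondY x.toKIdx g) A) (conjY (gBondY x.toKIdx g) A') =
      conjY (gSrcCornerY x.toKIdx g) ((c2YOfRecord N θ Mstar x).form U A A') :=
  c2LettersYOfRecord_form_gauge_of_unitary x.toKIdx hg U A A'

/-- ★★ **THE CERTIFICATE-TYPED FACE**: the record's law at a member for `SU(N)`-valued gauge functions (`G = SU(N) ⊂ U(N)`, p. 390).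
[cite: Balaban1985BackgroundPropagators, p.390 (G ⊂ U(N)), (3.34) p.396, (3.134) p.422] [cite: Balaban1985Averaging, (52) p.26] -/
theorem c2YOfRecord_form_gauge_SU (x : MemberY θ.d₆ θ.ℓ₆ θ.hd' θ.hL' θ.b₀ θ.b₁ Mstar) {g : GaugeY (Matrix (Fin N) (Fin N) ℂ) x.toKIdx}
    (hg : ∀ z, g z ∈ specialUnitaryUnits (Fin N)) (U : CfgY (Matrix (Fin N) (Fin N) ℂ) x.toKIdx)
    (A A' : FBondY x.toKIdx → Matrix (Fin N) (Fin N) ℂ) :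
    (c2YOfRecord N θ Mstar x).form (gaugeY x.toKIdx g U) (conjY (gBondY x.toKIdx g) A) (conjY (gBondY x.toKIdx g) A') =
      conjY (gSrcCornerY x.toKIdx g) ((c2YOfRecord N θ Mstar x).form U A A') :=
  c2YOfRecord_form_gauge_of_unitary N θ Mstar x (fun z => specialUnitaryUnits_le_unitaryUnits (hg z)) U A A'

end CovUC

end Literature.MathematicalPhysics.QuantumFieldTheory.Balaban1983to89.Node00
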